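import Summits.ResolutionOfSingularities.ResolutionOfSingularities.Theorems.WeightedInvariantGradedChartAlgebra
import Summits.ResolutionOfSingularities.ResolutionOfSingularities.Theorems.WeightedInvariantDatumToEmbeddedAtlasAmbientGraded
import Summits.ResolutionOfSingularities.ResolutionOfSingularities.Theorems.WeightedInvariantELadderOneOrbitOfDim
import HarnessLib

/-!
# Graded chart reading, II: the `ℤʲ`-grading of a torus-stable basic open `D(t) ⊆ W`

Cell `res-hironaka`, line `L W4.3`, door crux `HypersurfaceCentreConstruction` (stmt-ResolutionOfSingularities-19897),
E2 tier; residual (γ) of ORDER (o47-a) (res-D-pv-031), second «graded chart reading» file (shared with (C-b)/(S-c)).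
OURS / folklore; nothing here is a statement of [Hironaka2017]; AI-written, weaker than expert review.

For an affine open `W` of a scheme `Y`, a `ℤʲ`-grading `𝒜` of `Γ(Y, W)` (`AddSubgroup` pieces, as in
`Theorems.GradedAtlas`) and a HOMOGENEOUS section `t ∈ 𝒜 δ`:

* `awayGrading W 𝒜 ht` — the induced `ℤʲ`-grading of `Γ(Y, D(t))` (`AddSubgroup` pieces; the tree's `awayPiece` of
  `…DatumToEmbeddedAtlasAmbientGraded` read through `IsAffineOpen.isLocalization_basicOpen`, transported twice with
  `GradedChart.nonempty_gradedRing_of_mem_iff`); `nonempty_gradedRing_awayGrading`;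
* `algebraMap_mem_awayGrading` — restriction preserves degrees; `isHomogeneous_map_awayGrading` — a homogeneous ideal
  of `Γ(Y, W)` extends to a homogeneous ideal of `Γ(Y, D(t))`;
* `comap_primeIdealOf_basicOpen` / `primeIdealOf_basicOpen_eq_map` — the prime of a point `y ∈ D(t)` in `Γ(Y, D(t))` is
  the extension of its prime in `Γ(Y, W)`; hence `isHomogeneous_primeIdealOf_basicOpen`: it is homogeneous when the
  latter is;
* `isUnit_algebraMap_of_dvd` — a section dividing `t` becomes a unit on `D(t)`.

[folklore; EGA I §1.3, Bruns–Herzog §1.5]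
-/

noncomputable section

set_option linter.dupNamespace false -- mandated namespace of this single-conjunct summit

open CategoryTheory AlgebraicGeometry TopologicalSpace DirectSum
open Summit.ResolutionOfSingularities.ResolutionOfSingularities.Theorems.DatumToEmbedded.AtlasAmbient

namespace Summit.ResolutionOfSingularities.ResolutionOfSingularities.Theorems.GradedChart

universe u

variable {Y : Scheme.{u}} (W : Y.affineOpens) {j : ℕ} (𝒜 : (Fin j → ℤ) → AddSubgroup Γ(Y, W))
  {δ : Fin j → ℤ} {t : Γ(Y, W)}

/-! ## `AddSubgroup` pieces as `ℤ`-submodules -/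

/-- The pieces as `ℤ`-submodules (same members). [folklore] -/
abbrev intPiece (d : Fin j → ℤ) : Submodule ℤ Γ(Y, W) := AddSubgroup.toIntSubmodule (𝒜 d)

/-- Membership in `intPiece` is membership in the piece. [folklore] -/
theorem mem_intPiece_iff (d : Fin j → ℤ) (x : Γ(Y, W)) : x ∈ intPiece W 𝒜 d ↔ x ∈ 𝒜 d := Iff.rfl

/-- `intPiece` grades the ring whenever `𝒜` does. [folklore] -/
theorem nonempty_gradedRing_intPiece [GradedRing 𝒜] : Nonempty (GradedRing (intPiece W 𝒜)) :=
  nonempty_gradedRing_of_mem_iff 𝒜 (intPiece W 𝒜) (mem_intPiece_iff W 𝒜)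

/-- A graded-ring structure on `intPiece` (a choice; all such structures agree on membership, which is all that
is used below). [folklore] -/
@[reducible] def gradedRingIntPiece [GradedRing 𝒜] : GradedRing (intPiece W 𝒜) :=
  (nonempty_gradedRing_intPiece W 𝒜).some

variable [GradedRing 𝒜]

/-! ## The grading of `Γ(Y, D(t))` -/

/-- **The `ℤʲ`-grading of `Γ(Y, D(t))`** for a homogeneous section `t ∈ 𝒜 δ`: the piece of degree `k` consists of the
`y / tⁿ` with `y ∈ 𝒜 (k + n δ)` (`AddSubgroup` form of the tree's `awayPiece`, along the canonical algebra
structure `Γ(Y, W) → Γ(Y, D(t))`). [folklore] -/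
def awayGrading (ht : t ∈ 𝒜 δ) (k : Fin j → ℤ) : AddSubgroup Γ(Y, Y.basicOpen t) :=
  letI := gradedRingIntPiece W 𝒜
  (awayPiece (intPiece W 𝒜) ((mem_intPiece_iff W 𝒜 δ t).mpr ht) Γ(Y, Y.basicOpen t) k).toAddSubgroup

variable (ht : t ∈ 𝒜 δ)

/-- Membership in a piece of `awayGrading`. [folklore] -/
theorem mem_awayGrading_iff {k : Fin j → ℤ} {x : Γ(Y, Y.basicOpen t)} :
    x ∈ awayGrading W 𝒜 ht k ↔ ∃ n : ℕ, ∃ y ∈ 𝒜 (k + n • δ),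
      algebraMap Γ(Y, W) Γ(Y, Y.basicOpen t) t ^ n * x = algebraMap Γ(Y, W) Γ(Y, Y.basicOpen t) y :=
  Iff.rfl

/-- Membership in `awayGrading` is membership in the tree's `awayPiece` of `intPiece`. [folklore] -/
theorem mem_awayGrading_iff_mem_awayPiece {k : Fin j → ℤ} {x : Γ(Y, Y.basicOpen t)} :
    x ∈ awayGrading W 𝒜 ht k ↔
      letI := gradedRingIntPiece W 𝒜
      x ∈ awayPiece (intPiece W 𝒜) ((mem_intPiece_iff W 𝒜 δ t).mpr ht) Γ(Y, Y.basicOpen t) k :=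
  Iff.rfl

/-- **`awayGrading` grades `Γ(Y, D(t))`.** [folklore] -/
theorem nonempty_gradedRing_awayGrading : Nonempty (GradedRing (awayGrading W 𝒜 ht)) := by
  letI := gradedRingIntPiece W 𝒜
  haveI := W.2.isLocalization_basicOpen t
  obtain ⟨i2⟩ := nonempty_gradedRing_awayPiece (intPiece W 𝒜) ((mem_intPiece_iff W 𝒜 δ t).mpr ht)
    Γ(Y, Y.basicOpen t)
  letI := i2
  exact nonempty_gradedRing_of_mem_iff (awayPiece (intPiece W 𝒜) ((mem_intPiece_iff W 𝒜 δ t).mpr ht)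
    Γ(Y, Y.basicOpen t)) (awayGrading W 𝒜 ht) fun _ _ => Iff.rfl

/-- Restriction to `D(t)` preserves degrees. [folklore] -/
theorem algebraMap_mem_awayGrading {k : Fin j → ℤ} {y : Γ(Y, W)} (hy : y ∈ 𝒜 k) :
    algebraMap Γ(Y, W) Γ(Y, Y.basicOpen t) y ∈ awayGrading W 𝒜 ht k :=
  letI := gradedRingIntPiece W 𝒜
  algebraMap_mem_awayPiece ((mem_intPiece_iff W 𝒜 δ t).mpr ht) ((mem_intPiece_iff W 𝒜 k y).mpr hy)

/-- **A homogeneous ideal of `Γ(Y, W)` extends to a homogeneous ideal of `Γ(Y, D(t))`** (for any graded-ring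
structure on the target family). [folklore] -/
theorem isHomogeneous_map_awayGrading [GradedRing (awayGrading W 𝒜 ht)] {I : Ideal Γ(Y, W)}
    (hI : I.IsHomogeneous 𝒜) :
    (I.map (algebraMap Γ(Y, W) Γ(Y, Y.basicOpen t))).IsHomogeneous (awayGrading W 𝒜 ht) := by
  obtain ⟨T, rfl⟩ := (Ideal.IsHomogeneous.iff_exists 𝒜 _).mp hI
  rw [Ideal.map_span]
  refine Ideal.homogeneous_span _ _ ?_
  rintro _ ⟨_, ⟨s, _, rfl⟩, rfl⟩
  obtain ⟨k, hk⟩ := s.2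
  exact ⟨k, algebraMap_mem_awayGrading W 𝒜 ht hk⟩

/-! ## Primes of points of `D(t)` -/

/-- **The prime of `y ∈ D(t)` in `Γ(Y, W)` is the contraction of its prime in `Γ(Y, D(t))`.** [folklore] -/
theorem comap_primeIdealOf_basicOpen {y : Y} (hy : y ∈ Y.basicOpen t) :
    ((W.2.basicOpen t).primeIdealOf ⟨y, hy⟩).asIdeal.comap (algebraMap Γ(Y, W) Γ(Y, Y.basicOpen t)) =
      (W.2.primeIdealOf ⟨y, Y.basicOpen_le t hy⟩).asIdeal := by
  have h := IsAffineOpen.comap_primeIdealOf_appLE (f := 𝟙 Y) (W : Y.Opens) W.2 (Y.basicOpen t)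
    (W.2.basicOpen t) (Y.basicOpen_le t) hy
  have e : ((𝟙 Y : Y ⟶ Y).appLE (W : Y.Opens) (Y.basicOpen t) (Y.basicOpen_le t)).hom =
      algebraMap Γ(Y, W) Γ(Y, Y.basicOpen t) :=
    RingHom.ext fun _ => rfl
  rw [e] at h
  exact congrArg PrimeSpectrum.asIdeal h

/-- **The prime of `y ∈ D(t)` in `Γ(Y, D(t))` is the extension of its prime in `Γ(Y, W)`** (`Γ(Y, D(t))` is the
localisation of `Γ(Y, W)` at `t`). [folklore] -/
theorem primeIdealOf_basicOpen_eq_map {y : Y} (hy : y ∈ Y.basicOpen t) :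
    ((W.2.basicOpen t).primeIdealOf ⟨y, hy⟩).asIdeal =
      (W.2.primeIdealOf ⟨y, Y.basicOpen_le t hy⟩).asIdeal.map (algebraMap Γ(Y, W) Γ(Y, Y.basicOpen t)) := by
  haveI := W.2.isLocalization_basicOpen t
  rw [← comap_primeIdealOf_basicOpen W hy]
  exact (IsLocalization.map_under (Submonoid.powers t) Γ(Y, Y.basicOpen t) _).symm

/-- **The prime of `y ∈ D(t)` in `Γ(Y, D(t))` is homogeneous whenever its prime in `Γ(Y, W)` is.** [folklore] -/
theorem isHomogeneous_primeIdealOf_basicOpen [GradedRing (awayGrading W 𝒜 ht)] {y : Y}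
    (hy : y ∈ Y.basicOpen t) (hhom : ((W.2.primeIdealOf ⟨y, Y.basicOpen_le t hy⟩).asIdeal).IsHomogeneous 𝒜) :
    (((W.2.basicOpen t).primeIdealOf ⟨y, hy⟩).asIdeal).IsHomogeneous (awayGrading W 𝒜 ht) := by
  rw [primeIdealOf_basicOpen_eq_map W hy]
  exact isHomogeneous_map_awayGrading W 𝒜 ht hhom

/-! ## Units -/

/-- **A section dividing `t` is a unit on `D(t)`.** [folklore] -/
theorem isUnit_algebraMap_of_dvd {s : Γ(Y, W)} (hs : s ∣ t) :
    IsUnit (algebraMap Γ(Y, W) Γ(Y, Y.basicOpen t) s) := by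
  haveI := W.2.isLocalization_basicOpen t
  obtain ⟨r, rfl⟩ := hs
  have h := IsLocalization.Away.algebraMap_isUnit (S := Γ(Y, Y.basicOpen (s * r))) (s * r)
  rw [map_mul] at h
  exact isUnit_of_mul_isUnit_left h

/-- Units of prescribed degrees on `D(t)` from homogeneous divisors of `t`: if `s ∈ 𝒜 k` divides `t` then `Γ(Y, D(t))`
has a unit of degree `k`. [folklore] -/
theorem exists_isUnit_mem_awayGrading {k : Fin j → ℤ} {s : Γ(Y, W)} (hsk : s ∈ 𝒜 k) (hs : s ∣ t) :
    ∃ u ∈ awayGrading W 𝒜 ht k, IsUnit u :=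
  ⟨_, algebraMap_mem_awayGrading W 𝒜 ht hsk, isUnit_algebraMap_of_dvd W hs⟩

end Summit.ResolutionOfSingularities.ResolutionOfSingularities.Theorems.GradedChart

end
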